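import Summits.ResolutionOfSingularities.ResolutionOfSingularities.Theorems.EquisingularLiftEquisingularLiftNatIsoHypPointOfSingularPointsLinAut
import Summits.ResolutionOfSingularities.ResolutionOfSingularities.Theorems.EquisingularLiftEquisingularLiftNatSpecimenCiNoseInstances
import Summits.ResolutionOfSingularities.ResolutionOfSingularities.Theorems.EquisingularLiftEquisingularLiftNatMultiOrdinaryPointsJacobian
import HarnessLib

/-!
# [OURS] ★★★ EL♮ (route currency `ELNatAt`) FOR EVERY HYPERSURFACE WHOSE SINGULAR POINTS ARE ONE-STEP / FIRST-ORDER POINTS — ANY NUMBER, ANY POSITION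
# (cruxes `Theses.EquisingularLift.EquisingularLiftNat` / `…NatThree`, stmt-ResolutionOfSingularities-20038 / -20148)

[OURS · leafhand-res-equisingularlift-10 g0, 2026-08-31; cell `pub/decomp-res`] AI-produced, weaker than expert review; NOT a statement of any manuscript; nothing
here proves resolution of singularities in positive characteristic.  DEF-FREE helper; no `sorry`; standard axioms; ZERO named hypotheses.

Item (t3)/(e) of the lh7–lh9 repair censuses («> n + 1 one-step points / points not in linearly general position — XL, needs O-points through arbitrary
k-points») DONE, not through the one-product engine but through the LEAD's chain: ✓ `isoHypPoint_of_singularOneStepPoints_linAut` (p829768: the downstairs point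
chain, one point at a time) followed by T-ISO-0 (✓ `elNatAt_of_isoHypPoint`: Hensel sections through the blown-up points, lead res-L1-w45b).  The
locally-principal binder of the item is ✓ `HypersurfaceSpecimen.locallyPrincipal_hypersurfaceι`.

* ★★★ `elNatAt_of_singularOneStepPoints_linAut` — `K = K̄` of characteristic `p`; `F` a prime form; finitely many points, each with linear coordinates
  `(g, c)` in which the moved equation `linSubst ↑g⁻¹ F` is a prime form carrying seat res-D-pv-013's ONE-STEP datum of multiplicity `μ ≥ 2` at the vertex
  `P_c`; `V₊(F)` regular elsewhere ⟹ `Theorems.EquisingularLift.ELNatAt p K (m+2) V₊(F) ι`;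
* ★★ `elNatAt_of_singularFirstOrderPoints_linAut` — the same from hand 9's intrinsic FIRST-ORDER criterion per point («`Φ_μ`, `∇Φ_μ`, `Ψ_{μ+1}` have no
  common non-zero zero», ✓ `FirstOrderPoint.exists_strictTransform`): **every hypersurface of `ℙ^{m+2}_k̄` whose singular points are finitely many first-order
  points — ordinary multiple points, `A₂` points, characteristic-2 nodes, … — in ANY number and position satisfies EL♮** (e.g. all nodal surfaces, all
  surfaces with only `A₁`/`A₂` singularities), once the per-point charts are supplied;
* `isoHypPoint_of_singularFirstOrderPoints_linAut` — the `IsoHypPoint` (hypothesis #7) form of the latter.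

Honest label: closes no registered stub (the registered isolated residual `stub_elnat_three_isolated_nonNDLeaves9` already carries `¬ IsoHypPoint`).

References: [Hartshorne1977, I Thm. 5.1, I Ex. 5.8, II Example 7.1.1]; [StacksProject, Tag 080E]; [Liu2002, §8.1] — through the cited tree files.
-/

set_option linter.dupNamespace false -- mandated namespace `Summit.<Summit>.<Problem>` of this single-conjunct summit

noncomputable section

open CategoryTheory CategoryTheory.Limits AlgebraicGeometry TopologicalSpace
open MvPolynomial HomogeneousLocalization
open Literature.AlgebraicGeometry.Resolution Literature.AlgebraicGeometry.Motives Literature.AlgebraicGeometry.GroupSchemes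
open Literature.AlgebraicGeometry.Motives.SmoothHypersurface Literature.AlgebraicGeometry.Motives.ProjectiveSpace
open AlgebraicGeometry.Scheme.IdealSheafData
open Summit.ResolutionOfSingularities.ResolutionOfSingularities.Cruxes.EquisingularLift.StrataSplit

namespace Summit.ResolutionOfSingularities.ResolutionOfSingularities.Cruxes.EquisingularLiftNat.Sections

/-- ★★★ **EL♮ FOR HYPERSURFACES WHOSE SINGULAR POINTS ARE ONE-STEP POINTS IN ARBITRARY POSITION** (`K = K̄` of characteristic `p`; per-point linear
coordinates; multiplicity `μ ≥ 2`; `V₊(F)` regular elsewhere): `Theorems.EquisingularLift.ELNatAt p K (m+2) V₊(F) ι` — ✓ `isoHypPoint_of_singularOneStepPoints_linAut`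
then the lead's T-ISO-0 (✓ `elNatAt_of_isoHypPoint`), the locally-principal binder by ✓ `HypersurfaceSpecimen.locallyPrincipal_hypersurfaceι`. [OURS]
[cite: Hartshorne1977, I Thm. 5.1, II Example 7.1.1] [cite: StacksProject, Tag 080E] -/
theorem elNatAt_of_singularOneStepPoints_linAut (p : ℕ) (hp : p.Prime) (K : Type) [Field K] [CharP K p] [IsAlgClosed K] {m : ℕ}
    (F : MvPolynomial (Fin (m + 2 + 1)) K) {d : ℕ} (hF : F.IsHomogeneous d) (hFp : Prime F) (pts : List (GL (Fin (m + 2 + 1)) K × Fin (m + 2 + 1)))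
    (hone : ∀ gc ∈ pts,
      (ProjLinAction.linSubst K ((gc.1⁻¹ : GL (Fin (m + 2 + 1)) K) : Matrix (Fin (m + 2 + 1)) (Fin (m + 2 + 1)) K) F).IsHomogeneous d ∧
      Prime (ProjLinAction.linSubst K ((gc.1⁻¹ : GL (Fin (m + 2 + 1)) K) : Matrix (Fin (m + 2 + 1)) (Fin (m + 2 + 1)) K) F) ∧
      ∃ (μ : ℕ) (Φ Ψ : MvPolynomial (Fin (m + 2)) K), 2 ≤ μ ∧ Φ.IsHomogeneous μ ∧ Φ ≠ 0 ∧
        Ψ ∈ Ideal.span (Set.range (X : Fin (m + 2) → MvPolynomial (Fin (m + 2)) K)) ^ (μ + 1) ∧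
        ProjectiveSpace.dehomogenize K gc.2 (ProjLinAction.linSubst K ((gc.1⁻¹ : GL (Fin (m + 2 + 1)) K) :
          Matrix (Fin (m + 2 + 1)) (Fin (m + 2 + 1)) K) F) = Φ + Ψ ∧
        ∀ l : Fin (m + 2), ∃ G : MvPolynomial (Fin (m + 2)) K,
          aeval (fun j => X l * Function.update (X : Fin (m + 2) → MvPolynomial (Fin (m + 2)) K) l 1 j) (Φ + Ψ) = X l ^ μ * G ∧
          ∀ P : Ideal (MvPolynomial (Fin (m + 2)) K), P.IsPrime → (X l : MvPolynomial (Fin (m + 2)) K) ∈ P → G ∈ P → ∃ j, pderiv j G ∉ P)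
    (hreg : letI := MvPolynomial.gradedAlgebra (σ := Fin (m + 2 + 1)) (R := K)
      ∀ x : ↥(hypersurface F).left, (∀ gc ∈ pts, ¬ (∀ a : Fin (m + 2 + 1), a ≠ gc.2 →
        ProjLinAction.linSubst K (gc.1 : Matrix (Fin (m + 2 + 1)) (Fin (m + 2 + 1)) K) (X a) ∈ ((hypersurfaceι F).left x).asHomogeneousIdeal)) →
        IsRegularLocalRing ((hypersurface F).left.presheaf.stalk x)) :
    letI := MvPolynomial.gradedAlgebra (σ := Fin (m + 2 + 1)) (R := K)
    Theorems.EquisingularLift.ELNatAt p K (m + 2) (hypersurface F).left (hypersurfaceι F).left := by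
  letI := MvPolynomial.gradedAlgebra (σ := Fin (m + 2 + 1)) (R := K)
  haveI := HypersurfaceSpecimen.isIntegral_hypersurface_of_prime K F hF hFp
  have hd : 0 < d := ConeN.pos_of_prime_of_isHomogeneous K F hF hFp
  exact elNatAt_of_isoHypPoint p hp K (m + 2) (hypersurface F).left (hypersurfaceι F).left inferInstance inferInstance
    (HypersurfaceSpecimen.locallyPrincipal_hypersurfaceι F hF hd (fun c => MultiOrd.radical_span_dehomogenize_eq_of_prime F hF hFp c))
    (isoHypPoint_of_singularOneStepPoints_linAut K F hF hFp pts hone hreg)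

/-- `IsoHypPoint` from FIRST-ORDER data in per-point linear coordinates (✓ `FirstOrderPoint.exists_strictTransform` supplies the strict transforms). [OURS]
[cite: Hartshorne1977, I Thm. 5.1, I Ex. 5.8] -/
theorem isoHypPoint_of_singularFirstOrderPoints_linAut (K : Type) [Field K] [IsAlgClosed K] {m : ℕ}
    (F : MvPolynomial (Fin (m + 2 + 1)) K) {d : ℕ} (hF : F.IsHomogeneous d) (hFp : Prime F) (pts : List (GL (Fin (m + 2 + 1)) K × Fin (m + 2 + 1)))
    (hfo : ∀ gc ∈ pts,
      (ProjLinAction.linSubst K ((gc.1⁻¹ : GL (Fin (m + 2 + 1)) K) : Matrix (Fin (m + 2 + 1)) (Fin (m + 2 + 1)) K) F).IsHomogeneous d ∧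
      Prime (ProjLinAction.linSubst K ((gc.1⁻¹ : GL (Fin (m + 2 + 1)) K) : Matrix (Fin (m + 2 + 1)) (Fin (m + 2 + 1)) K) F) ∧
      ∃ (μ : ℕ) (Φ Ψ₁ Ψ' : MvPolynomial (Fin (m + 2)) K), 2 ≤ μ ∧ Φ.IsHomogeneous μ ∧ Φ ≠ 0 ∧ Ψ₁.IsHomogeneous (μ + 1) ∧
        Ψ' ∈ Ideal.span (Set.range (X : Fin (m + 2) → MvPolynomial (Fin (m + 2)) K)) ^ (μ + 2) ∧
        ProjectiveSpace.dehomogenize K gc.2 (ProjLinAction.linSubst K ((gc.1⁻¹ : GL (Fin (m + 2 + 1)) K) :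
          Matrix (Fin (m + 2 + 1)) (Fin (m + 2 + 1)) K) F) = Φ + (Ψ₁ + Ψ') ∧
        ∀ P : Ideal (MvPolynomial (Fin (m + 2)) K), P.IsPrime → Φ ∈ P → (∀ i, pderiv i Φ ∈ P) → Ψ₁ ∈ P →
          ∀ i, (X i : MvPolynomial (Fin (m + 2)) K) ∈ P)
    (hreg : letI := MvPolynomial.gradedAlgebra (σ := Fin (m + 2 + 1)) (R := K)
      ∀ x : ↥(hypersurface F).left, (∀ gc ∈ pts, ¬ (∀ a : Fin (m + 2 + 1), a ≠ gc.2 →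
        ProjLinAction.linSubst K (gc.1 : Matrix (Fin (m + 2 + 1)) (Fin (m + 2 + 1)) K) (X a) ∈ ((hypersurfaceι F).left x).asHomogeneousIdeal)) →
        IsRegularLocalRing ((hypersurface F).left.presheaf.stalk x)) :
    letI := MvPolynomial.gradedAlgebra (σ := Fin (m + 2 + 1)) (R := K)
    IsoHypPoint K (m + 2) (hypersurface F).left (hypersurfaceι F).left := by
  letI := MvPolynomial.gradedAlgebra (σ := Fin (m + 2 + 1)) (R := K)
  refine isoHypPoint_of_singularOneStepPoints_linAut K F hF hFp pts (fun gc hgc => ?_) hreg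
  obtain ⟨h1, h2, μ, Φ, Ψ₁, Ψ', hμ, hΦ, hΦ0, hΨ₁, hΨ', hdeh, hcrit⟩ := hfo gc hgc
  exact ⟨h1, h2, μ, Φ, Ψ₁ + Ψ', hμ, hΦ, hΦ0, FirstOrderPoint.add_mem_pow_succ K hΨ₁ hΨ', hdeh,
    fun l => FirstOrderPoint.exists_strictTransform K Φ Ψ₁ Ψ' hΦ hΨ₁ hΨ' hcrit l⟩

/-- ★★ **EL♮ FOR EVERY HYPERSURFACE WHOSE SINGULAR POINTS ARE FIRST-ORDER POINTS — any number, any position** (`K = K̄` of characteristic `p`; per-point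
linear coordinates; hand 9's intrinsic criterion with multiplicity `μ ≥ 2`; `V₊(F)` regular elsewhere).  Ordinary multiple points, `A₂` points and
characteristic-2 nodes are first-order (✓ `FirstOrderPoint.firstOrder_A₂`, ✓ `firstOrder_node`). [OURS] [cite: Hartshorne1977, I Thm. 5.1, I Ex. 5.8] -/
theorem elNatAt_of_singularFirstOrderPoints_linAut (p : ℕ) (hp : p.Prime) (K : Type) [Field K] [CharP K p] [IsAlgClosed K] {m : ℕ}
    (F : MvPolynomial (Fin (m + 2 + 1)) K) {d : ℕ} (hF : F.IsHomogeneous d) (hFp : Prime F) (pts : List (GL (Fin (m + 2 + 1)) K × Fin (m + 2 + 1)))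
    (hfo : ∀ gc ∈ pts,
      (ProjLinAction.linSubst K ((gc.1⁻¹ : GL (Fin (m + 2 + 1)) K) : Matrix (Fin (m + 2 + 1)) (Fin (m + 2 + 1)) K) F).IsHomogeneous d ∧
      Prime (ProjLinAction.linSubst K ((gc.1⁻¹ : GL (Fin (m + 2 + 1)) K) : Matrix (Fin (m + 2 + 1)) (Fin (m + 2 + 1)) K) F) ∧
      ∃ (μ : ℕ) (Φ Ψ₁ Ψ' : MvPolynomial (Fin (m + 2)) K), 2 ≤ μ ∧ Φ.IsHomogeneous μ ∧ Φ ≠ 0 ∧ Ψ₁.IsHomogeneous (μ + 1) ∧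
        Ψ' ∈ Ideal.span (Set.range (X : Fin (m + 2) → MvPolynomial (Fin (m + 2)) K)) ^ (μ + 2) ∧
        ProjectiveSpace.dehomogenize K gc.2 (ProjLinAction.linSubst K ((gc.1⁻¹ : GL (Fin (m + 2 + 1)) K) :
          Matrix (Fin (m + 2 + 1)) (Fin (m + 2 + 1)) K) F) = Φ + (Ψ₁ + Ψ') ∧
        ∀ P : Ideal (MvPolynomial (Fin (m + 2)) K), P.IsPrime → Φ ∈ P → (∀ i, pderiv i Φ ∈ P) → Ψ₁ ∈ P →
          ∀ i, (X i : MvPolynomial (Fin (m + 2)) K) ∈ P)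
    (hreg : letI := MvPolynomial.gradedAlgebra (σ := Fin (m + 2 + 1)) (R := K)
      ∀ x : ↥(hypersurface F).left, (∀ gc ∈ pts, ¬ (∀ a : Fin (m + 2 + 1), a ≠ gc.2 →
        ProjLinAction.linSubst K (gc.1 : Matrix (Fin (m + 2 + 1)) (Fin (m + 2 + 1)) K) (X a) ∈ ((hypersurfaceι F).left x).asHomogeneousIdeal)) →
        IsRegularLocalRing ((hypersurface F).left.presheaf.stalk x)) :
    letI := MvPolynomial.gradedAlgebra (σ := Fin (m + 2 + 1)) (R := K)
    Theorems.EquisingularLift.ELNatAt p K (m + 2) (hypersurface F).left (hypersurfaceι F).left := by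
  letI := MvPolynomial.gradedAlgebra (σ := Fin (m + 2 + 1)) (R := K)
  haveI := HypersurfaceSpecimen.isIntegral_hypersurface_of_prime K F hF hFp
  have hd : 0 < d := ConeN.pos_of_prime_of_isHomogeneous K F hF hFp
  exact elNatAt_of_isoHypPoint p hp K (m + 2) (hypersurface F).left (hypersurfaceι F).left inferInstance inferInstance
    (HypersurfaceSpecimen.locallyPrincipal_hypersurfaceι F hF hd (fun c => MultiOrd.radical_span_dehomogenize_eq_of_prime F hF hFp c))
    (isoHypPoint_of_singularFirstOrderPoints_linAut K F hF hFp pts hfo hreg)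

end Summit.ResolutionOfSingularities.ResolutionOfSingularities.Cruxes.EquisingularLiftNat.Sections

end
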